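import Summits.Ventures.HSemireg.Mod4TwoSlopeSpectrumGeneral

/-!
# Venture HSemireg — MOD-4 line: the middle Hankel rank `r_n` of an `I_Z`-SHAPE h-part (`q_0 ≠ 0` allowed, `q_1 = … = q_{n−1} = 0`,
# `q_n ≠ 0`, any tail) is `n + 1` or `n`, according as the square Hankel determinant `det (q_{i+j})_{i,j ≤ n}` is non-zero or zero

HONEST FRAMING. Part of the Lean index of the computation cell `pub-hsemireg` (seat w3-mod4-1 gen 15, W3 SPECIAL FIBRES; file of
record `HOME/widen/W3/MOD4-OFFSPLIT-w3mod4.md` §13.23 («NOT the 1 − ch(O_Z) shape, whose middle Hankel determinant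
q_0(q_nq_{2n} − …) − q_n^{n+1}-type can vanish») and §13.34). ELEMENTARY LINEAR ALGEBRA over a field ONLY: no abelian variety, no
sheaf, no Ext group, no semiregularity map; nothing here says that HC / HC_CM / HC_AV holds; no Literature fact is declared; NO
definition is introduced.  Companion of `Mod4LeadingTermMiddle` (`r_n = n + 1` when `q_0 = 0` too).

WHAT IS PROVED (`K` a field; `H_n(q) = hankel1 K (2n) n q`, the `(n+1) × (n+1)` middle Hankel matrix `(q_{i+s})`; `Hsq` the same
matrix indexed by `Fin (n+1) × Fin (n+1)`, a hypothesis `hH : Hsq = Matrix.of fun i j => q (i + j)` — no definition):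
* **`eq_zero_of_vecMul_hankel1_idealShape`** — `q_m = 0` for `1 ≤ m < n`, `q_n ≠ 0`, `v H_n = 0`, `v_0 = 0` ⇒ `v = 0` (column `j` isolates
  `v_{n−j} q_n` once `v_0 = 0` and the larger rows vanish);
* **`le_hankel1_rank_idealShape`** — `n ≤ rank H_n(q)` (the left kernel has dimension `≤ 1`: `v ↦ v_0` is injective on it);
* **`hankel1_eq_submatrix`**, **`hankel1_rank_eq_rank_sq`** — `H_n(q)` is `Hsq` re-indexed along `Fin (2n + 1 − n) ≃ Fin (n + 1)`, same rank;
* **`hankel1_rank_idealShape_of_det_ne_zero`** — `det Hsq ≠ 0` ⇒ `rank H_n(q) = n + 1`;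
* **`hankel1_rank_idealShape_of_det_eq_zero`** — `det Hsq = 0` ⇒ `rank H_n(q) = n` (a non-zero left kernel vector exists, so the left
  kernel is exactly `1`-dimensional).
READING: TABLE R's «1 − ch(O_Z)» row has `r_n ∈ {n, n + 1}`, decided by ONE determinant (affine in `q_0`: `det Hsq = q_0·det(q_{i+j})_{1≤i,j≤n}
± q_n^{n+1}`, the expansion itself not typed here); with `Mod4IdealShapePinZero` this feeds the real-carrier middle entry of the `I_Z`
row. Everything PROVED, 0 sorry. Namespace `Summit.Ventures.HSemireg.Mod4`. References: [BourbakiAlgebre1a3] Ch. III §8;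
[BuchweitzFlenner2008HH] Prop. 6.4.4 (why these ranks).
-/

namespace Summit.Ventures.HSemireg.Mod4

open Finset Matrix

variable {K : Type*} [Field K]

/-- **left kernel vectors of the `I_Z` middle Hankel matrix with `v_0 = 0` vanish** (`q_m = 0` for `1 ≤ m < n`, `q_n ≠ 0`): column `j` of
`v H_n(q) = 0` reads `v_{n−j} q_n = 0` once `v_0 = 0` and the rows above `n − j` are known to vanish. [cite: BourbakiAlgebre1a3, Ch. III §8] -/
theorem eq_zero_of_vecMul_hankel1_idealShape {n : ℕ} {q : ℕ → K} (hq : ∀ m, 1 ≤ m → m < n → q m = 0) (hqn : q n ≠ 0)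
    {v : Fin (n + 1) → K} (hv : v ᵥ* Wedge.Hankel.hankel1 K (n + n) n q = 0) (hv0 : v ⟨0, by omega⟩ = 0) : v = 0 := by
  have hcol : ∀ s : ℕ, s < n + n + 1 - n → ∑ i : Fin (n + 1), v i * q ((i : ℕ) + s) = 0 := by
    intro s hs
    have h := congr_fun hv ⟨s, hs⟩
    simpa [Matrix.vecMul, dotProduct, Wedge.Hankel.hankel1, Matrix.of_apply] using h
  have key : ∀ j, j ≤ n → v ⟨n - j, by omega⟩ = 0 := by
    intro j
    refine Nat.strong_induction_on j ?_
    intro j ih hj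
    by_cases hjn : j = n
    · subst hjn
      simpa using hv0
    have h := hcol j (by omega)
    rw [Finset.sum_eq_single (⟨n - j, by omega⟩ : Fin (n + 1))] at h
    · have hidx : (n - j) + j = n := by omega
      rw [show ((⟨n - j, by omega⟩ : Fin (n + 1)) : ℕ) = n - j from rfl, hidx] at h
      exact (mul_eq_zero.mp h).resolve_right hqn
    · intro i _ hi
      have hi' : (i : ℕ) ≠ n - j := fun h => hi (Fin.ext h)
      have hil := i.isLt
      by_cases hlt : n - j < (i : ℕ)
      · have h' := ih (n - (i : ℕ)) (by omega) (by omega)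
        have hfin : (⟨n - (n - (i : ℕ)), by omega⟩ : Fin (n + 1)) = i := Fin.ext (by simp only; omega)
        rw [hfin] at h'
        rw [h', zero_mul]
      · rcases Nat.eq_zero_or_pos (i : ℕ) with hi0 | hi0
        · have : i = ⟨0, by omega⟩ := Fin.ext hi0
          rw [this, hv0, zero_mul]
        · rw [hq _ (by omega) (by omega), mul_zero]
    · intro h
      exact absurd (Finset.mem_univ _) h
  funext i
  have hi := i.isLt
  have h := key (n - (i : ℕ)) (by omega)
  have hfin : (⟨n - (n - (i : ℕ)), by omega⟩ : Fin (n + 1)) = i := Fin.ext (by simp only; omega)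
  rw [hfin] at h
  rw [h, Pi.zero_apply]

/-- **`n ≤ rank H_n(q)` for an `I_Z` shape** (`q_m = 0` for `1 ≤ m < n`, `q_n ≠ 0`): the left kernel of `H_n(q)` is at most `1`-dimensional.
[cite: BourbakiAlgebre1a3, Ch. III §8] -/
theorem le_hankel1_rank_idealShape {n : ℕ} {q : ℕ → K} (hq : ∀ m, 1 ≤ m → m < n → q m = 0) (hqn : q n ≠ 0) :
    n ≤ (Wedge.Hankel.hankel1 K (n + n) n q).rank := by
  set H := Wedge.Hankel.hankel1 K (n + n) n q with hH
  rw [← Matrix.rank_transpose]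
  change n ≤ Module.finrank K ↥(LinearMap.range Hᵀ.mulVecLin)
  have hrn := LinearMap.finrank_range_add_finrank_ker Hᵀ.mulVecLin
  rw [Module.finrank_fintype_fun_eq_card, Fintype.card_fin] at hrn
  -- the kernel is at most one-dimensional: `v ↦ v 0` is injective on it
  set W := LinearMap.ker Hᵀ.mulVecLin with hW
  let f : ↥W →ₗ[K] K := (LinearMap.proj (⟨0, by omega⟩ : Fin (n + 1))) ∘ₗ W.subtype
  have hf : Function.Injective f := by
    rw [← LinearMap.ker_eq_bot, LinearMap.ker_eq_bot']
    intro v hv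
    have hv0 : (v : Fin (n + 1) → K) ⟨0, by omega⟩ = 0 := by simpa [f] using hv
    have hvW : (v : Fin (n + 1) → K) ∈ LinearMap.ker Hᵀ.mulVecLin := v.2
    rw [LinearMap.mem_ker, Matrix.mulVecLin_apply, Matrix.mulVec_transpose] at hvW
    exact Subtype.ext (eq_zero_of_vecMul_hankel1_idealShape hq hqn hvW hv0)
  have hker : Module.finrank K ↥W ≤ 1 := by
    have h := LinearMap.finrank_le_finrank_of_injective hf
    rwa [Module.finrank_self] at h
  omega

omit [Field K] in
/-- `H_n(q)` is the square Hankel matrix `(q_{i+j})_{i,j ≤ n}` re-indexed along `Fin (n + 1) → Fin (2n + 1 − n)`. -/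
theorem hankel1_eq_submatrix (n : ℕ) (q : ℕ → K) {Hsq : Matrix (Fin (n + 1)) (Fin (n + 1)) K}
    (hHsq : Hsq = Matrix.of fun i j : Fin (n + 1) => q ((i : ℕ) + (j : ℕ))) :
    Wedge.Hankel.hankel1 K (n + n) n q = Hsq.submatrix id (finCongr (show n + n + 1 - n = n + 1 by omega)) := by
  ext i s
  simp [Wedge.Hankel.hankel1, hHsq, Matrix.submatrix_apply]

/-- `rank H_n(q) = rank Hsq`. -/
theorem hankel1_rank_eq_rank_sq (n : ℕ) (q : ℕ → K) {Hsq : Matrix (Fin (n + 1)) (Fin (n + 1)) K}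
    (hHsq : Hsq = Matrix.of fun i j : Fin (n + 1) => q ((i : ℕ) + (j : ℕ))) :
    (Wedge.Hankel.hankel1 K (n + n) n q).rank = Hsq.rank := by
  rw [hankel1_eq_submatrix n q hHsq]
  exact Matrix.rank_submatrix Hsq (Equiv.refl _) (finCongr _)

/-- **`det Hsq ≠ 0` ⇒ `rank H_n(q) = n + 1`.** [cite: BourbakiAlgebre1a3, Ch. III §8] -/
theorem hankel1_rank_idealShape_of_det_ne_zero (n : ℕ) (q : ℕ → K) {Hsq : Matrix (Fin (n + 1)) (Fin (n + 1)) K}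
    (hHsq : Hsq = Matrix.of fun i j : Fin (n + 1) => q ((i : ℕ) + (j : ℕ))) (hdet : Hsq.det ≠ 0) :
    (Wedge.Hankel.hankel1 K (n + n) n q).rank = n + 1 := by
  rw [hankel1_rank_eq_rank_sq n q hHsq]
  have hU : IsUnit Hsq := (Matrix.isUnit_iff_isUnit_det Hsq).mpr (isUnit_iff_ne_zero.mpr hdet)
  rw [Matrix.rank_of_isUnit Hsq hU, Fintype.card_fin]

/-- **`det Hsq = 0` ⇒ `rank H_n(q) = n`** for an `I_Z` shape (`q_m = 0` for `1 ≤ m < n`, `q_n ≠ 0`): the left kernel is non-trivial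
(`det = 0`) and at most `1`-dimensional. [cite: BourbakiAlgebre1a3, Ch. III §8] -/
theorem hankel1_rank_idealShape_of_det_eq_zero {n : ℕ} {q : ℕ → K} (hq : ∀ m, 1 ≤ m → m < n → q m = 0) (hqn : q n ≠ 0)
    {Hsq : Matrix (Fin (n + 1)) (Fin (n + 1)) K} (hHsq : Hsq = Matrix.of fun i j : Fin (n + 1) => q ((i : ℕ) + (j : ℕ)))
    (hdet : Hsq.det = 0) : (Wedge.Hankel.hankel1 K (n + n) n q).rank = n := by
  refine le_antisymm ?_ (le_hankel1_rank_idealShape hq hqn)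
  rw [hankel1_rank_eq_rank_sq n q hHsq]
  -- a non-zero kernel vector of `Hsq` bounds the rank by `n`
  obtain ⟨v, hv0, hv⟩ := Matrix.exists_mulVec_eq_zero_iff.mpr hdet
  have hrn := LinearMap.finrank_range_add_finrank_ker Hsq.mulVecLin
  rw [Module.finrank_fintype_fun_eq_card, Fintype.card_fin] at hrn
  have hker : 1 ≤ Module.finrank K ↥(LinearMap.ker Hsq.mulVecLin) := by
    rw [Nat.one_le_iff_ne_zero]
    intro h0
    rw [Submodule.finrank_eq_zero] at h0
    have hmem : v ∈ LinearMap.ker Hsq.mulVecLin := by rw [LinearMap.mem_ker, Matrix.mulVecLin_apply, hv]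
    rw [h0, Submodule.mem_bot] at hmem
    exact hv0 hmem
  change Module.finrank K ↥(LinearMap.range Hsq.mulVecLin) ≤ n
  omega

end Summit.Ventures.HSemireg.Mod4
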